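import Summits.ResolutionOfSingularities.ResolutionOfSingularities.Theorems.WeightedInvariantLocalWeightedDropTrackT4Main
import Summits.ResolutionOfSingularities.ResolutionOfSingularities.Theorems.WeightedInvariantLocalWeightedDropTameResidualOfTupleDrop

/-!
# Track T4: TAME DOUBLE POINTS IN FOUR VARIABLES ARE WON, modulo the corrected Cossart–Jannsen–Saito fact F-32bR

[OURS · L1 W4.3 · chain w43, Track T4, brick B4; stub worker 4] Engine crux `LocalWeightedDrop` (stmt-ResolutionOfSingularities-8899),
registered skeleton v28 (b8b73808bd522080), residual stub T″ `stub_tameWideApexHigherStartsWon` at `N = 4`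
(res-L1-w43-strat-1's `stub_tameWideApexFourStartsWon`), sub-piece `d = 2`.  NOT a statement of any manuscript; the games are the
programme's own.

`tameDoublePointsFourWon_of_CJSB`: modulo F-32bR (`CossartJannsenSaito2020EmbeddedSequenceB`, Cossart–Jannsen–Saito, LNM 2270 (2020),
Thm. 1.4 + Thm. 6.9 (a): embedded resolution of two-dimensional reduced excellent schemes), over an algebraically closed field of
characteristic `p ≠ 2`, EVERY singular germ `f ∈ k⟦x₀,x₁,x₂,x₃⟧` of order `2` — every threefold hypersurface DOUBLE POINT — is in the
winning region `CobordantGame.Won k 4` of the local weighted resolution game.  Proof: the tame-multiplicity lift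
`TameLift.preparedWon_of_drop` (Tschirnhaus form `y² + a₀(x₀,x₁,x₂)`, `p ∤ 2`) needs the one-entry tuple game `TupleGame.Drop k 3 0`
(Track T4, `TrackT4.tupleDropThreeZero_of_CJSB`) and the singular germs of order `< 2` — there are none.  This is the first `N = 4`
piece of the engine banked modulo a printed fact; the rest of T″ at `N = 4` (`d ≥ 3`, `p ∤ d`) is `TupleGame.Drop k 3 e`, `e ≥ 1`
(`tameWideApexFourStartsWon_of_tupleDrop`), whose printed input (idealistic exponents with several marked entries on regular
threefolds) is only partially in print (Cossart–Piltant 2008 Prop. 4.4, `dim V(J) ≤ 1`).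
-/

noncomputable section

set_option linter.dupNamespace false -- mandated namespace of this single-conjunct summit

namespace Summit.ResolutionOfSingularities.ResolutionOfSingularities.Theorems

open Literature.AlgebraicGeometry.Resolution
open Literature.AlgebraicGeometry.Resolution.CobordantGame

/-- **TAME DOUBLE POINTS IN FOUR VARIABLES ARE WON, modulo F-32bR.** Over an algebraically closed field of characteristic `p ≠ 2`,
every singular germ `f ∈ k⟦x₀,x₁,x₂,x₃⟧` of order `2` is won in the local weighted resolution game.
[OURS · L1 W4.3 · chain w43 Track T4; CONDITIONAL on the named printed fact `CossartJannsenSaito2020EmbeddedSequenceB`] -/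
theorem tameDoublePointsFourWon_of_CJSB (hCJS : CossartJannsenSaito2020EmbeddedSequenceB.{0})
    (p : ℕ) (hp : p.Prime) (hp2 : p ≠ 2) (k : Type) [Field k] [CharP k p] [IsAlgClosed k]
    (f : MvPowerSeries (Fin 4) k) (hf : IsSingular k f) (hfd : f.order = 2) : Won k 4 f := by
  have hpd : ¬ p ∣ (0 + 2) := fun h => hp2 ((Nat.prime_dvd_prime_iff_eq hp Nat.prime_two).mp h)
  refine TameLift.preparedWon_of_drop p hp k 3 0 (TrackT4.tupleDropThreeZero_of_CJSB hCJS k) (fun G hG hlt => ?_)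
    f hf (by rw [hfd]; rfl) hpd
  -- no singular germ has order `< 2`
  exfalso
  have h2 : (2 : ℕ∞) ≤ G.order := (FormalCoordChange.two_le_order_iff G).mpr hG.2
  have : ((0 + 2 : ℕ) : ℕ∞) = 2 := by norm_num
  rw [this] at hlt
  exact absurd (lt_of_le_of_lt h2 hlt) (lt_irrefl _)

/-- **The same, in the quantifier shape of the engine's residual stubs** (`∀ p prime, ∀ k …`, order hypothesis as `f.order = d`
with `d = 2`): the `d = 2` slice of T″ at `N = 4` (`ResidualSplit.stub_tameWideApexFourStartsWon`), none of whose other hypotheses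
is needed. [OURS · L1 W4.3; CONDITIONAL on F-32bR] -/
theorem tameWideApexFourStartsWon_two_of_CJSB (hCJS : CossartJannsenSaito2020EmbeddedSequenceB.{0}) :
    ∀ (p : ℕ), p.Prime → ∀ (k : Type) [Field k] [CharP k p] [IsAlgClosed k]
      (f : MvPowerSeries (Fin 4) k), IsSingular k f → f.order = (2 : ℕ) → ¬ p ∣ 2 → Won k 4 f :=
  fun p hp k _ _ _ f hf hfd hpd =>
    tameDoublePointsFourWon_of_CJSB hCJS p hp (fun h => hpd (h ▸ dvd_rfl)) k f hf (by rw [hfd]; rfl)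

end Summit.ResolutionOfSingularities.ResolutionOfSingularities.Theorems

end
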